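import Mathlib
import HarnessLib

/-!
# Route `AdditiveBranchIMC` (rung K1), cruxes 19357 / 19359, supply stubs `stub_fieldSupplyR0` /
# `stub_fieldSupplyM`: the ARITHMETIC of FIELD 2 (the `p`-ramified Kolyvagin field)

Cell `bsd-addord`, seat `bsd-line-addord-w2`. THEOREMS ONLY, pure elementary number theory (no curve):

* §1 `exists_prime_jacobiSym_prescribed` — a Dirichlet prime `ℓ₀ > B` in a prescribed class modulo `8`
  with prescribed Legendre symbols `(ℓ₀ / ℓ) = ε_ℓ` at finitely many odd primes `ℓ` (CRT + a quadratic
  non-residue + Dirichlet's theorem on primes in arithmetic progressions, all Mathlib).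
* §2 `jacobiSym_rootNumber_sign` — the SIGN COMPUTATION behind `w(X) = −1` for the auxiliary curve
  `X ≅ V^{(T)}` of the supply: if `w(V^{(p*)}) = +1`, i.e. `(−1/p)(N/p)·w(V) = 1`, and the odd fundamental
  discriminant `T` satisfies `(p*T / ℓ) = 1` at every odd prime `ℓ ∣ N`, `p*T ≡ 1 (mod 8)` if `2 ∣ N`,
  and `p*T < 0`, then `(−1/|T|)(N/|T|)·w(V) = −1`. (Jacobi reciprocity in the form
  `J(n | u) = J(u* | n)`, `u* = χ₄(u)u`; `J(2 | u) = χ₈(u)`; `J(−1 | u) = χ₄(u)`.)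

References: [IrelandRosen1990] Ch. 5 §2 (Jacobi symbol), [SilvermanAEC2009] App. C §16;
Murty–Murty 1997 Ch. 6 §1 (sign of a twisted newform).
-/

set_option linter.dupNamespace false

noncomputable section

open scoped Classical

namespace Summit.BirchSwinnertonDyer.BirchSwinnertonDyer.Theorems.ThreeFieldRoadSupply

open NumberTheorySymbols ZMod

/-! ### §1 A Dirichlet prime with prescribed Legendre symbols -/

/-- For an odd prime `ℓ` and a sign `ε = ±1` there is a residue `r` with `ℓ ∤ r` and `(r/ℓ) = ε`
(`r = 1`, or a quadratic non-residue). [folklore] -/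
theorem exists_residue_jacobiSym_eq {ℓ : ℕ} (hℓ : ℓ.Prime) (hℓ2 : ℓ ≠ 2) {ε : ℤ} (hε : ε = 1 ∨ ε = -1) :
    ∃ r : ℕ, r % ℓ ≠ 0 ∧ J(r | ℓ) = ε := by
  haveI := Fact.mk hℓ
  rcases hε with rfl | rfl
  · refine ⟨1, ?_, by exact_mod_cast jacobiSym.one_left ℓ⟩
    rw [Nat.one_mod_eq_one.mpr hℓ.one_lt.ne']
    exact one_ne_zero
  · have hchar : ringChar (ZMod ℓ) ≠ 2 := by rwa [ZMod.ringChar_zmod_n]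
    obtain ⟨a, ha⟩ := FiniteField.exists_nonsquare hchar
    have ha0 : a ≠ 0 := by rintro rfl; exact ha (IsSquare.zero)
    refine ⟨a.val, ?_, ?_⟩
    · rw [Nat.mod_eq_of_lt (ZMod.val_lt a)]
      exact (ZMod.val_ne_zero a).mpr ha0
    · rw [← jacobiSym.legendreSym.to_jacobiSym, legendreSym.eq_neg_one_iff']
      simpa [ZMod.natCast_zmod_val] using ha

/-- **CRT for residues at finitely many odd primes and at `8`.** [folklore] -/
theorem exists_nat_prescribed_residues (S : Finset ℕ) (hS : ∀ ℓ ∈ S, ℓ.Prime ∧ ℓ ≠ 2)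
    (r : ℕ → ℕ) (c : ℕ) :
    ∃ k : ℕ, k % 8 = c % 8 ∧ ∀ ℓ ∈ S, k % ℓ = r ℓ % ℓ := by
  induction S using Finset.induction_on with
  | empty => exact ⟨c, rfl, by simp⟩
  | @insert ℓ S hℓS ih =>
    obtain ⟨k₀, hk₀8, hk₀⟩ := ih (fun x hx ↦ hS x (Finset.mem_insert_of_mem hx))
    obtain ⟨hℓ, hℓ2⟩ := hS ℓ (Finset.mem_insert_self ℓ S)
    have hcop : Nat.Coprime (8 * ∏ x ∈ S, x) ℓ := by
      refine Nat.Coprime.mul_left ?_ ?_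
      · have h2 : Nat.Coprime 2 ℓ := (Nat.coprime_primes Nat.prime_two hℓ).mpr (Ne.symm hℓ2)
        simpa using h2.pow_left 3
      · refine Nat.Coprime.prod_left fun x hx ↦ ?_
        have hxp := (hS x (Finset.mem_insert_of_mem hx)).1
        refine (Nat.coprime_primes hxp hℓ).mpr ?_
        rintro rfl
        exact hℓS hx
    obtain ⟨k, hk1, hk2⟩ := Nat.chineseRemainder hcop k₀ (r ℓ)
    refine ⟨k, ?_, fun x hx ↦ ?_⟩
    · have h8 : k ≡ k₀ [MOD 8] := hk1.of_dvd (dvd_mul_right 8 _)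
      rw [h8, hk₀8]
    · rcases Finset.mem_insert.mp hx with rfl | hx
      · exact hk2
      · have hxd : x ∣ 8 * ∏ y ∈ S, y := Dvd.dvd.mul_left (Finset.dvd_prod_of_mem _ hx) 8
        have hmod : k ≡ k₀ [MOD x] := hk1.of_dvd hxd
        rw [hmod, hk₀ x hx]

/-- **A Dirichlet prime with prescribed local behaviour**: for finitely many odd primes `ℓ ∈ S` with
signs `ε_ℓ = ±1`, an odd class `c (mod 8)` and a bound `B`, there is a prime `ℓ₀ > B` with
`ℓ₀ ≡ c (mod 8)` and `(ℓ₀ / ℓ) = ε_ℓ` for all `ℓ ∈ S` (Chinese remainder theorem, a quadratic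
non-residue modulo each `ℓ`, and Dirichlet's theorem on primes in arithmetic progressions).
[cite: IrelandRosen1990, Ch. 16 §1 (Dirichlet's theorem)] -/
theorem exists_prime_jacobiSym_prescribed (S : Finset ℕ) (hS : ∀ ℓ ∈ S, ℓ.Prime ∧ ℓ ≠ 2)
    (ε : ℕ → ℤ) (hε : ∀ ℓ ∈ S, ε ℓ = 1 ∨ ε ℓ = -1) (c : ℕ) (hc : c % 2 = 1) (B : ℕ) :
    ∃ ℓ₀ : ℕ, ℓ₀.Prime ∧ B < ℓ₀ ∧ ℓ₀ % 8 = c % 8 ∧ ∀ ℓ ∈ S, J(ℓ₀ | ℓ) = ε ℓ := by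
  -- residues
  have hr : ∀ ℓ, ∃ r : ℕ, ℓ ∈ S → r % ℓ ≠ 0 ∧ J(r | ℓ) = ε ℓ := by
    intro ℓ
    by_cases hℓ : ℓ ∈ S
    · obtain ⟨r, hr⟩ := exists_residue_jacobiSym_eq (hS ℓ hℓ).1 (hS ℓ hℓ).2 (hε ℓ hℓ)
      exact ⟨r, fun _ ↦ hr⟩
    · exact ⟨0, fun h ↦ (hℓ h).elim⟩
  choose r hr using hr
  obtain ⟨k, hk8, hk⟩ := exists_nat_prescribed_residues S hS r c
  -- the modulus and the unit class
  set M : ℕ := 8 * ∏ x ∈ S, x with hM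
  have hM0 : M ≠ 0 := by
    rw [hM]
    exact mul_ne_zero (by norm_num) (Finset.prod_ne_zero_iff.mpr fun x hx ↦ (hS x hx).1.ne_zero)
  have hcopk : Nat.Coprime k M := by
    rw [hM]
    refine Nat.Coprime.mul_right ?_ ?_
    · have hodd : k % 2 = 1 := by omega
      have h2 : Nat.Coprime k 2 := Nat.coprime_two_right.mpr (Nat.odd_iff.mpr hodd)
      simpa using h2.pow_right 3
    · refine Nat.Coprime.prod_right fun x hx ↦ ?_
      have hxp := (hS x hx).1
      rw [Nat.coprime_comm, Nat.Prime.coprime_iff_not_dvd hxp]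
      intro hdvd
      apply (hr x hx).1
      rw [← hk x hx]
      exact Nat.mod_eq_zero_of_dvd hdvd
  have hcopZ : IsCoprime (k : ℤ) (M : ℤ) := Nat.isCoprime_iff_coprime.mpr hcopk
  obtain ⟨ℓ₀, hℓ₀B, hℓ₀, hmod⟩ :=
    Nat.forall_exists_prime_gt_and_zmodEq B (q := M) (a := (k : ℤ)) hM0 hcopZ
  refine ⟨ℓ₀, hℓ₀, hℓ₀B, ?_, fun ℓ hℓ ↦ ?_⟩
  · have h8 : (ℓ₀ : ℤ) ≡ k [ZMOD 8] := hmod.of_dvd (by rw [hM]; exact_mod_cast dvd_mul_right 8 _)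
    have h8' : ℓ₀ % 8 = k % 8 := by
      have := Int.ModEq.eq h8
      omega
    rw [h8', hk8]
  · have hℓd : (ℓ : ℤ) ∣ (M : ℤ) := by
      rw [hM]; exact_mod_cast Dvd.dvd.mul_left (Finset.dvd_prod_of_mem _ hℓ) 8
    have hmodℓ : (ℓ₀ : ℤ) ≡ k [ZMOD ℓ] := hmod.of_dvd hℓd
    have hkr : (k : ℤ) % ℓ = (r ℓ : ℤ) % ℓ := by exact_mod_cast congrArg (Nat.cast : ℕ → ℤ) (hk ℓ hℓ)
    have h1 : (ℓ₀ : ℤ) % ℓ = (r ℓ : ℤ) % ℓ := (Int.ModEq.eq hmodℓ).trans hkr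
    rw [jacobiSym.mod_left' h1, (hr ℓ hℓ).2]

/-! ### §2 The sign computation for the auxiliary curve of field 2 -/

/-- `J(a | n) = 1` as soon as `J(a | ℓ) = 1` for every prime `ℓ ∣ n` (`n ≠ 0`). [folklore] -/
theorem jacobiSym_eq_one_of_forall_prime (a : ℤ) {n : ℕ} (hn : n ≠ 0)
    (h : ∀ ℓ : ℕ, ℓ.Prime → ℓ ∣ n → J(a | ℓ) = 1) : J(a | n) = 1 := by
  rw [← Nat.prod_primeFactorsList hn, jacobiSym.list_prod_right
    (fun x hx ↦ (Nat.prime_of_mem_primeFactorsList hx).ne_zero)]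
  refine List.prod_eq_one fun x hx ↦ ?_
  obtain ⟨ℓ, hℓ, rfl⟩ := List.mem_map.mp hx
  exact h ℓ (Nat.prime_of_mem_primeFactorsList hℓ) (Nat.dvd_of_mem_primeFactorsList hℓ)

/-- An integer `T ≡ 1 (mod 4)` is `χ₄(|T|)·|T|`. [folklore] -/
theorem eq_χ₄_natAbs_mul_of_emod_four {T : ℤ} (hT4 : T % 4 = 1) :
    (χ₄ (T.natAbs : ZMod 4) : ℤ) * (T.natAbs : ℤ) = T := by
  rcases lt_or_ge T 0 with hneg | hpos
  · have habs : (T.natAbs : ℤ) = -T := Int.ofNat_natAbs_of_nonpos hneg.le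
    have h3 : T.natAbs % 4 = 3 := by omega
    rw [ZMod.χ₄_nat_three_mod_four h3, habs]
    ring
  · have habs : (T.natAbs : ℤ) = T := Int.natAbs_of_nonneg hpos
    have h1 : T.natAbs % 4 = 1 := by omega
    rw [ZMod.χ₄_nat_one_mod_four h1, habs]
    ring

/-- **The sign of the auxiliary twist.** `p` an odd prime, `p* = (−1)^{(p−1)/2} p`; `T ≡ 1 (mod 4)`;
`N ≠ 0`; `wV = ±1` with `J(−1 | p)·J(N | p)·wV = 1` (i.e. `w(V^{(p*)}) = +1` by the twisting formula);
`J(p*T | ℓ) = 1` for every odd prime `ℓ ∣ N`; `p*T ≡ 1 (mod 8)` if `2 ∣ N`; and `p*T < 0`. Then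
`J(−1 | |T|)·J(N | |T|)·wV = −1` (i.e. `w(V^{(T)}) = −1`). Proof: with `u = p|T|` one has
`p*T = χ₄(u)u`, so the left side times the hypothesis is `χ₄(u)·J(N | u)`; write `N = 2^e n`, `n`
odd: `J(n | u) = J(χ₄(u)u | n) = J(p*T | n) = 1` (Jacobi reciprocity, prime by prime), `J(2 | u) =
χ₈(u) = 1` when `e ≥ 1` (`χ₄(u)u ≡ 1 (mod 8)` forces `u ≡ ±1 (mod 8)`), and `χ₄(u) = −1` because
`χ₄(u)u < 0`. [cite: IrelandRosen1990, Ch. 5 §2 Prop. 5.2.2 (Jacobi reciprocity)] -/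
theorem jacobiSym_rootNumber_sign {p : ℕ} (hp : p.Prime) (hp2 : p ≠ 2) {T : ℤ} (hT4 : T % 4 = 1)
    {N : ℕ} (hN0 : N ≠ 0) {wV : ℤ} (hwV : wV = 1 ∨ wV = -1)
    (h1 : J(-1 | p) * J((N : ℤ) | p) * wV = 1)
    (hb : ∀ ℓ : ℕ, ℓ.Prime → ℓ ∣ N → ℓ ≠ 2 → J((-1) ^ (p / 2) * p * T | ℓ) = 1)
    (h8 : 2 ∣ N → ((-1 : ℤ) ^ (p / 2) * p * T) % 8 = 1)
    (hneg : (-1 : ℤ) ^ (p / 2) * p * T < 0) :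
    J(-1 | T.natAbs) * J((N : ℤ) | T.natAbs) * wV = -1 := by
  -- the odd number `u = p |T|` and the identity `p* T = χ₄(u) u`
  have hT0 : T ≠ 0 := by rintro rfl; norm_num at hT4
  have hTa0 : T.natAbs ≠ 0 := Int.natAbs_ne_zero.mpr hT0
  have hpodd : p % 2 = 1 := Nat.odd_iff.mp (hp.eq_two_or_odd'.resolve_left hp2)
  have hTodd : T.natAbs % 2 = 1 := by omega
  set u : ℕ := p * T.natAbs with hu
  have hu0 : u ≠ 0 := mul_ne_zero hp.ne_zero hTa0
  have huodd : Odd u := Nat.odd_mul.mpr ⟨Nat.odd_iff.mpr hpodd, Nat.odd_iff.mpr hTodd⟩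
  have huodd' : u % 2 = 1 := Nat.odd_iff.mp huodd
  have hkey : ((-1 : ℤ) ^ (p / 2) * p * T) = (χ₄ (u : ZMod 4) : ℤ) * (u : ℤ) := by
    have hp4 : (χ₄ (p : ZMod 4) : ℤ) = (-1) ^ (p / 2) := ZMod.χ₄_eq_neg_one_pow hpodd
    have hT := eq_χ₄_natAbs_mul_of_emod_four hT4
    rw [hu, Nat.cast_mul, Nat.cast_mul, map_mul, ← hp4]
    calc (χ₄ (p : ZMod 4) : ℤ) * (p : ℤ) * T
        = (χ₄ (p : ZMod 4) : ℤ) * (p : ℤ) * ((χ₄ (T.natAbs : ZMod 4) : ℤ) * (T.natAbs : ℤ)) := by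
          rw [hT]
      _ = _ := by ring
  have hχu : χ₄ (u : ZMod 4) = 1 ∨ χ₄ (u : ZMod 4) = -1 := by
    rw [ZMod.χ₄_nat_eq_if_mod_four]
    simp only [huodd', one_ne_zero, if_false]
    split_ifs <;> simp
  -- `χ₄(u) = -1` from the sign
  have hχneg : χ₄ (u : ZMod 4) = -1 := by
    rcases hχu with h | h
    · exfalso
      rw [hkey, h, one_mul] at hneg
      exact (not_lt.mpr (by positivity)) hneg
    · exact h
  -- reduce the goal to `χ₄(u) · J(N | u) = -1`
  have hwsq : wV * wV = 1 := by rcases hwV with rfl | rfl <;> norm_num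
  have hw' : J(-1 | p) * J((N : ℤ) | p) = wV := by
    have := congrArg (· * wV) h1
    simp only [mul_assoc, hwsq, mul_one, one_mul] at this
    simpa [mul_assoc] using this
  haveI : NeZero p := ⟨hp.ne_zero⟩
  haveI : NeZero T.natAbs := ⟨hTa0⟩
  have hgoal : J(-1 | T.natAbs) * J((N : ℤ) | T.natAbs) * wV =
      J(-1 | u) * J((N : ℤ) | u) := by
    rw [← hw', hu, mul_comm p, jacobiSym.mul_right, jacobiSym.mul_right]
    ring
  rw [hgoal, jacobiSym.at_neg_one huodd]
  -- `N = 2^e n`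
  obtain ⟨e, n, hn, hN⟩ := Nat.exists_eq_two_pow_mul_odd hN0
  have hn0 : n ≠ 0 := by rintro rfl; simp at hn
  have hJN : J((N : ℤ) | u) = J(2 | u) ^ e * J((n : ℤ) | u) := by
    rw [hN, Nat.cast_mul, Nat.cast_pow, jacobiSym.mul_left, jacobiSym.pow_left]
    norm_num
  -- `J(n | u) = J(p* T | n) = 1`
  have hJn : J((n : ℤ) | u) = 1 := by
    rw [jacobiSym.quadratic_reciprocity' hn huodd, qrSign, ← jacobiSym.mul_left, ← hkey]
    refine jacobiSym_eq_one_of_forall_prime _ hn0 fun ℓ hℓ hℓn ↦ hb ℓ hℓ ?_ ?_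
    · rw [hN]; exact Dvd.dvd.mul_left hℓn _
    · rintro rfl
      exact (Nat.not_even_iff_odd.mpr hn) (even_iff_two_dvd.mpr hℓn)
  -- `J(2 | u)^e = 1`
  have hJ2 : J(2 | u) ^ e = 1 := by
    rcases Nat.eq_zero_or_pos e with rfl | he
    · rw [pow_zero]
    · have h2N : 2 ∣ N := by rw [hN]; exact Dvd.dvd.mul_right (dvd_pow_self 2 he.ne') n
      have h81 := h8 h2N
      rw [hkey, hχneg] at h81
      have hu8 : u % 8 = 1 ∨ u % 8 = 7 := by omega
      rw [jacobiSym.at_two huodd, ZMod.χ₈_nat_eq_if_mod_eight]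
      simp only [huodd', one_ne_zero, if_false, hu8, if_true, one_pow]
  rw [hJN, hJn, hJ2, hχneg]
  norm_num

/-- An odd square is `≡ 1 (mod 8)`. [folklore] -/
theorem Int.mul_self_emod_eight_of_odd {m : ℤ} (hm : m % 2 = 1) : (m * m) % 8 = 1 := by
  have h8 : (m * m) % 8 = ((m % 8) * (m % 8)) % 8 := Int.mul_emod m m 8
  have hr0 : 0 ≤ m % 8 := Int.emod_nonneg m (by norm_num)
  have hr8 : m % 8 < 8 := Int.emod_lt_of_pos m (by norm_num)
  have hodd : (m % 8) % 2 = 1 := by omega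
  rw [h8]
  generalize m % 8 = r at hr0 hr8 hodd ⊢
  interval_cases r <;> simp_all

/-- **The auxiliary prime of field 2.** For distinct odd primes `p`, `q`, a sign `σ`, finitely many odd
primes `ℓ ∈ S` with prescribed signs `η_ℓ = ±1`, and a bound `B`: a prime `ℓ₀ > B` with
`(−1)^{(ℓ₀−1)/2} = σ`, `p* q* ℓ₀* ≡ 1 (mod 8)` and `(ℓ₀* / ℓ) = η_ℓ` for all `ℓ ∈ S`
(`x* = (−1)^{(x−1)/2} x`). [cite: IrelandRosen1990, Ch. 16 §1 (Dirichlet's theorem)] -/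
theorem exists_prime_star_prescribed {p q : ℕ} (hp : p.Prime) (hp2 : p ≠ 2) (hq : q.Prime)
    (hq2 : q ≠ 2) {σ : ℤ} (hσ : σ = 1 ∨ σ = -1) (S : Finset ℕ) (hS : ∀ ℓ ∈ S, ℓ.Prime ∧ ℓ ≠ 2)
    (η : ℕ → ℤ) (hη : ∀ ℓ ∈ S, η ℓ = 1 ∨ η ℓ = -1) (B : ℕ) :
    ∃ ℓ₀ : ℕ, ℓ₀.Prime ∧ B < ℓ₀ ∧ ((-1 : ℤ) ^ (ℓ₀ / 2)) = σ ∧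
      ((-1 : ℤ) ^ (p / 2) * p * ((-1 : ℤ) ^ (q / 2) * q) * ((-1 : ℤ) ^ (ℓ₀ / 2) * ℓ₀)) % 8 = 1 ∧
      ∀ ℓ ∈ S, J((-1 : ℤ) ^ (ℓ₀ / 2) * ℓ₀ | ℓ) = η ℓ := by
  set m : ℤ := (-1 : ℤ) ^ (p / 2) * p * ((-1 : ℤ) ^ (q / 2) * q) with hm
  have hpodd : (p : ℤ) % 2 = 1 := by exact_mod_cast Nat.odd_iff.mp (hp.eq_two_or_odd'.resolve_left hp2)
  have hqodd : (q : ℤ) % 2 = 1 := by exact_mod_cast Nat.odd_iff.mp (hq.eq_two_or_odd'.resolve_left hq2)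
  have hsgn : ∀ k : ℕ, ((-1 : ℤ) ^ k) % 4 = 1 ∨ ((-1 : ℤ) ^ k) % 4 = 3 := fun k ↦ by
    rcases neg_one_pow_eq_or ℤ k with h | h <;> rw [h] <;> decide
  have hm4 : m % 4 = 1 := by
    -- `p* ≡ 1 (mod 4)` and `q* ≡ 1 (mod 4)`
    have hps : ((-1 : ℤ) ^ (p / 2) * p) % 4 = 1 := by
      have hp4 : (p : ℤ) % 4 = 1 ∨ (p : ℤ) % 4 = 3 := by omega
      have : ((-1 : ℤ) ^ (p / 2)) = if p % 4 = 1 then 1 else -1 := by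
        rw [← ZMod.χ₄_eq_neg_one_pow (by exact_mod_cast hpodd), ZMod.χ₄_nat_eq_if_mod_four]
        simp only [show p % 2 = 1 by exact_mod_cast hpodd, one_ne_zero, if_false]
      rw [this]
      split_ifs with h4
      · omega
      · have : (p : ℤ) % 4 = 3 := by omega
        rw [Int.mul_emod, this]; decide
    have hqs : ((-1 : ℤ) ^ (q / 2) * q) % 4 = 1 := by
      have : ((-1 : ℤ) ^ (q / 2)) = if q % 4 = 1 then 1 else -1 := by
        rw [← ZMod.χ₄_eq_neg_one_pow (by exact_mod_cast hqodd), ZMod.χ₄_nat_eq_if_mod_four]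
        simp only [show q % 2 = 1 by exact_mod_cast hqodd, one_ne_zero, if_false]
      rw [this]
      split_ifs with h4
      · omega
      · have : (q : ℤ) % 4 = 3 := by omega
        rw [Int.mul_emod, this]; decide
    rw [hm, Int.mul_emod, hps, hqs]; decide
  have hm2 : m % 2 = 1 := by omega
  -- the class modulo `8`
  set c : ℕ := ((σ * m) % 8).toNat with hc
  have hc0 : (0 : ℤ) ≤ (σ * m) % 8 := Int.emod_nonneg _ (by norm_num)
  have hcZ : (c : ℤ) = (σ * m) % 8 := by rw [hc, Int.toNat_of_nonneg hc0]
  have hσm2 : (σ * m) % 2 = 1 := by rcases hσ with rfl | rfl <;> omega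
  have hc2 : c % 2 = 1 := by
    have : (c : ℤ) % 2 = 1 := by rw [hcZ]; omega
    omega
  have hc4 : (c : ℤ) % 4 = if σ = 1 then 1 else 3 := by
    rw [hcZ]
    rcases hσ with rfl | rfl
    · simp only [if_true]; omega
    · simp only [show (-1 : ℤ) ≠ 1 by decide, if_false]; omega
  -- the prescribed residues, corrected by `J((−1)^{(c−1)/2} | ℓ)`
  set s : ℤ := (-1 : ℤ) ^ (c / 2) with hs
  have hs1 : s = 1 ∨ s = -1 := neg_one_pow_eq_or ℤ _
  have hsℓ : ∀ ℓ ∈ S, J(s | ℓ) = 1 ∨ J(s | ℓ) = -1 := fun ℓ hℓ ↦ by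
    refine jacobiSym.eq_one_or_neg_one ?_
    rcases hs1 with h | h <;> rw [h] <;> simp
  obtain ⟨ℓ₀, hℓ₀, hBℓ₀, hℓ₀8, hJ⟩ := exists_prime_jacobiSym_prescribed S hS (fun ℓ ↦ J(s | ℓ) * η ℓ)
    (fun ℓ hℓ ↦ by
      rcases hsℓ ℓ hℓ with h | h <;> rcases hη ℓ hℓ with h' | h' <;> rw [h, h'] <;> norm_num) c hc2 B
  have hℓ₀odd : ℓ₀ % 2 = 1 := by omega
  -- `(−1)^{(ℓ₀−1)/2} = (−1)^{(c−1)/2} = σ`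
  have hstar : ((-1 : ℤ) ^ (ℓ₀ / 2)) = s := by
    rw [hs, ← ZMod.χ₄_eq_neg_one_pow hℓ₀odd, ← ZMod.χ₄_eq_neg_one_pow hc2, ZMod.χ₄_nat_mod_four,
      ZMod.χ₄_nat_mod_four (n := c)]
    congr 2
    omega
  have hsσ : s = σ := by
    rw [hs, ← ZMod.χ₄_eq_neg_one_pow hc2, ZMod.χ₄_nat_eq_if_mod_four]
    simp only [hc2, one_ne_zero, if_false]
    rcases hσ with rfl | rfl
    · simp only [if_true] at hc4
      rw [if_pos (by omega)]
    · simp only [show (-1 : ℤ) ≠ 1 by decide, if_false] at hc4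
      rw [if_neg (by omega)]
  refine ⟨ℓ₀, hℓ₀, hBℓ₀, hstar.trans hsσ, ?_, fun ℓ hℓ ↦ ?_⟩
  · -- `m · (σ ℓ₀) ≡ m σ σ m = m² ≡ 1 (mod 8)`
    rw [hstar, hsσ]
    have hℓ₀Z : (ℓ₀ : ℤ) % 8 = (σ * m) % 8 := by
      have h1 : (ℓ₀ : ℤ) % 8 = (c : ℤ) % 8 := by exact_mod_cast hℓ₀8
      rw [h1, hcZ, Int.emod_emod_of_dvd _ (dvd_refl (8 : ℤ))]
    have hσσ : σ * σ = 1 := by rcases hσ with rfl | rfl <;> norm_num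
    calc (m * (σ * (ℓ₀ : ℤ))) % 8 = ((m * σ) * (ℓ₀ : ℤ)) % 8 := by congr 1; ring
      _ = ((m * σ) % 8) * ((ℓ₀ : ℤ) % 8) % 8 := Int.mul_emod _ _ _
      _ = ((m * σ) % 8) * ((σ * m) % 8) % 8 := by rw [hℓ₀Z]
      _ = ((m * σ) * (σ * m)) % 8 := (Int.mul_emod _ _ _).symm
      _ = (m * m) % 8 := by rw [show m * σ * (σ * m) = (σ * σ) * (m * m) by ring, hσσ, one_mul]
      _ = 1 := Int.mul_self_emod_eight_of_odd hm2
  · rw [hstar, jacobiSym.mul_left, hJ ℓ hℓ, ← mul_assoc, ← sq]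
    rcases hsℓ ℓ hℓ with h | h <;> rw [h] <;> norm_num

end Summit.BirchSwinnertonDyer.BirchSwinnertonDyer.Theorems.ThreeFieldRoadSupply

end
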